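import Literature.NumberTheory.PAdicHodge.DeRhamOfPeriodHoms
import HarnessLib

/-!
# A cocycle whose PERIODS are coboundaries is a coboundary in `B ⊗ V` (functional form of
# "Kummer classes die in `H¹(F, B_dR ⊗ V)`")

Topic `Literature/NumberTheory/PAdicHodge`; §1 in namespace `Literature.NumberTheory.GaloisRepresentations.PeriodRingData`
(sequel of the functional admissibility criterion `isAdmissible_of_equivariant` of `DeRhamOfPeriodHoms`), §2 in
`Literature.NumberTheory.PAdicHodge`. THEOREMS ONLY (no definition, no named fact, no instance, no `sorry`).

Let `𝔅` be a period-ring datum over `(Γ, P, E)` (Fontaine's regular `(P, Γ)`-ring `B`, `B^Γ = E`), `ρ` a representation of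
`Γ` on `V` with `dim_P V = n`, and `φ₀, …, φ_{n−1} : V → B` `P`-linear, `Γ`-equivariant, `E`-linearly independent — the
situation in which `V` is `B`-admissible (`isAdmissible_of_equivariant`: the matrix `H = (φᵢ(vⱼ))` is invertible and
`σ(H) = H·R(σ)`). THEN PERIODS DETECT COBOUNDARIES:

* §1 **`exists_tensorRep_sub_eq_of_equivariant`**: if `c : Γ → V` is ANY map and `b₀, …, b_{n−1} ∈ B` integrate its periods,
  `φᵢ(c(σ)) = σ(bᵢ) − bᵢ` for all `σ, i`, then `σ ↦ 1 ⊗ c(σ)` is a coboundary of `B ⊗_P V`: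
  `∃ x ∈ B ⊗ V, ∀ σ, 1 ⊗ c(σ) = σ(x) − x` (diagonal action `𝔅.tensorRep ρ`). Proof: in a basis, `x` has coordinates
  `H⁻¹ b`; `σ(x) − x` has coordinates `R(σ)σ(H⁻¹)σ(b) − H⁻¹b = H⁻¹(σ b − b) = H⁻¹ H γ(σ) = γ(σ)`, the coordinates of `c(σ)`
  (`R(σ)σ(H⁻¹) = H⁻¹` is the period-matrix relation). Pair form `exists_tensorRep_sub_eq_of_pair_of_fil` (`dim V = 2`,
  `φ₁(V) ⊆ Fil^i ∌ φ₂(m)`).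
* §2 the Tate-module dialect of the cite-only fact (S5a) `expStarCoord_eq_zero_iff_kummer` (file `DualExpElliptic`):
  **`exists_tensorRep_sub_eq_restrictedRationalTateRep_of_periodHoms`** — for `W/K₀`, `K₀ ⊆ F`, two additive `ℤ_p`-homogeneous
  `Γ_F`-equivariant period maps `φ₁ φ₂ : T_pW → B_dR(F)` with `φ₁ ≠ 0`, `φ₁ ⊆ Fil¹ ∌ φ₂(τ)`, and a map `η : Γ_F → T_pW` whose two
  periods are coboundaries (`φᵢ(η σ) = σ bᵢ − bᵢ`): `∃ x ∈ B_dR ⊗ V_pW, ∀ σ, 1 ⊗ η(σ) = σ(x) − x` for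
  `restrictedRationalTateRep W F p` and `bdRPeriodRingData hp` — i.e. the class of `η` DIES in `H¹(F, B_dR ⊗ V_pW)`.

Use (brick K1 of the hT₂ programme of crux K★ `stmt-BirchSwinnertonDyer-22226`, line kato_lever): the integrating pair
`(b_ω, b_η)` of the Kummer cocycle of a rational formal point (`AinfWeierstrassKummerIntegral{,Eta}`:
`(σ−1)b_ω = ∫_{κσ} ω`, `(σ−1)b_η = ∫_{κσ} η`) is exactly the hypothesis `hc` for the two period maps `∫ω, ∫η`. What is NOT
here: the `Fil⁰` refinement `x ∈ B_dR⁺ ⊗ V` (`IsFilZeroCoboundary`; Bloch–Kato Lemma 3.8.1: `H¹(B_dR⁺ ⊗ V) ↪ H¹(B_dR ⊗ V)` for de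
Rham `V`, equivalently `D_dR(V) ↠ ((B_dR/B_dR⁺) ⊗ V)^Γ` — adjust `x` by an invariant), and the matching `T_pŴ ≅ T_pW`. BSD / K★ are
not proved by any of this.

## References
* [FontaineAsterisque223III] J.-M. Fontaine, Astérisque 223 (1994), Exp. III Prop. 1.5.2, Thm. 1.5.2 (period matrices).
* [BlochKato1990] S. Bloch, K. Kato, *L-functions and Tamagawa numbers of motives* (1990), Ex. 3.10.1, (3.11.1), Lemma 3.8.1.
* [Kato1993LNM1553] K. Kato, LNM 1553 (1993), Ch. II Lemma 1.4.3.
-/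

noncomputable section

open Matrix
open scoped TensorProduct

/-! ## §1 Coboundaries from integrated periods -/

namespace Literature.NumberTheory.GaloisRepresentations.PeriodRingData

section PeriodHoms

-- Mathlib's own global value of `maxSynthPendingDepth` (see `PeriodRingData.finrank_D_le_holds`).
set_option maxSynthPendingDepth 3

universe u v v' w w'

variable {Γ : Type u} [Group Γ] [TopologicalSpace Γ] {P : Type v} {E : Type v'} [Field P]
  [TopologicalSpace P] [Field E] [Algebra P E]
  {M : Type w'} [AddCommGroup M] [Module P M] [TopologicalSpace M]
  (𝔅 : PeriodRingData.{u, v, v', w} Γ P E) (ρ : ContinuousRep Γ P M)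

/-- The diagonal action on a `B`-combination of the `1 ⊗ vᵢ`, VECTOR form: `σ(∑ᵢ aᵢ (1 ⊗ vᵢ)) = ∑ₖ (R(σ)·σ(a))ₖ (1 ⊗ vₖ)`.
[cite: FontaineAsterisque223III, Exp. III §1.5] -/
theorem tensorRep_sum_smul_basis_vec {ι : Type*} [Fintype ι] [DecidableEq ι] (v : Module.Basis ι P M)
    (σ : Γ) (a : ι → 𝔅.B) :
    𝔅.tensorRep ρ σ (∑ i, a i • Algebra.TensorProduct.basis 𝔅.B v i) =
      ∑ k, ((LinearMap.toMatrix v v (ρ σ)).map (algebraMap P 𝔅.B) *ᵥ (fun i => σ • a i)) k •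
        Algebra.TensorProduct.basis 𝔅.B v k := by
  rw [map_sum]
  simp_rw [tensorRep_apply_smul, tensorRep_basis_apply, Finset.smul_sum, smul_smul]
  rw [Finset.sum_comm]
  refine Finset.sum_congr rfl fun k _ => ?_
  rw [← Finset.sum_smul, Matrix.mulVec, dotProduct]
  refine congrArg (· • Algebra.TensorProduct.basis 𝔅.B v k) (Finset.sum_congr rfl fun i _ => ?_)
  rw [Matrix.map_apply, mul_comm]

omit [TopologicalSpace Γ] [TopologicalSpace P] [TopologicalSpace M] in
/-- `1 ⊗ m` in the `B`-basis `1 ⊗ vₖ`: `1 ⊗ m = ∑ₖ (coordₖ m) (1 ⊗ vₖ)`. [cite: FontaineAsterisque223III, Exp. III §1.5] -/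
theorem one_tmul_eq_sum_basis {ι : Type*} [Fintype ι] [DecidableEq ι] (v : Module.Basis ι P M) (m : M) :
    ((1 : 𝔅.B) ⊗ₜ[P] m : 𝔅.B ⊗[P] M) = ∑ k, algebraMap P 𝔅.B (v.repr m k) • Algebra.TensorProduct.basis 𝔅.B v k := by
  conv_lhs => rw [← v.sum_repr m]
  rw [TensorProduct.tmul_sum]
  refine Finset.sum_congr rfl fun k _ => ?_
  rw [TensorProduct.tmul_smul, algebraMap_smul, Algebra.TensorProduct.basis_apply]

omit [TopologicalSpace Γ] [TopologicalSpace P] [TopologicalSpace M] in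
/-- A functional in coordinates: `φ(m) = ∑ₖ coordₖ(m) · φ(vₖ)`. [cite: FontaineAsterisque223III, Exp. III §1.5] -/
theorem apply_eq_sum_basis {ι : Type*} [Fintype ι] (v : Module.Basis ι P M) (φ : M →ₗ[P] 𝔅.B) (m : M) :
    φ m = ∑ k, algebraMap P 𝔅.B (v.repr m k) * φ (v k) := by
  conv_lhs => rw [← v.sum_repr m]
  rw [map_sum]
  refine Finset.sum_congr rfl fun k _ => ?_
  rw [map_smul, Algebra.smul_def]

/-- **Periods detect coboundaries.** `ρ` on `V`, `dim_P V = n`; `φ₀, …, φ_{n−1} : V → B` `P`-linear, `Γ`-equivariant,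
`E`-linearly independent (so `V` is `B`-admissible); `c : Γ → V` any map and `b : Fin n → B` with `φᵢ(c σ) = σ bᵢ − bᵢ` for all
`i, σ`. Then `σ ↦ 1 ⊗ c(σ)` is a coboundary of the diagonal representation on `B ⊗_P V`:
`∃ x, ∀ σ, 1 ⊗ c(σ) = σ(x) − x` (`x = ∑ₖ (H⁻¹b)ₖ (1 ⊗ vₖ)`, `H = (φᵢ(vⱼ))`, using `R(σ)σ(H⁻¹) = H⁻¹`).
[cite: FontaineAsterisque223III, Exp. III Prop. 1.5.2 and Thm. 1.5.2] [cite: BlochKato1990, Ex. 3.10.1] -/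
theorem exists_tensorRep_sub_eq_of_equivariant [FiniteDimensional P M] {n : ℕ} (hn : Module.finrank P M = n)
    {Φ : Fin n → (M →ₗ[P] 𝔅.B)} (hΦ : ∀ i σ m, Φ i (ρ σ m) = σ • Φ i m)
    (hli : LinearIndependent E Φ) (c : Γ → M) (b : Fin n → 𝔅.B) (hc : ∀ i σ, Φ i (c σ) = σ • b i - b i) :
    ∃ x : 𝔅.B ⊗[P] M, ∀ σ, ((1 : 𝔅.B) ⊗ₜ[P] c σ : 𝔅.B ⊗[P] M) = 𝔅.tensorRep ρ σ x - x := by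
  classical
  let v : Module.Basis (Fin n) P M := Module.finBasisOfFinrankEq P M hn
  let H : Matrix (Fin n) (Fin n) 𝔅.B := Matrix.of fun i j => Φ i (v j)
  let R : Γ → Matrix (Fin n) (Fin n) P := fun σ => LinearMap.toMatrix v v (ρ σ)
  let g : Γ → 𝔅.B →+* 𝔅.B := fun σ => MulSemiringAction.toRingHom Γ 𝔅.B σ
  have hliB : LinearIndependent 𝔅.B Φ := 𝔅.linearIndependent_of_equivariant ρ hΦ hli
  -- (1) `det H ≠ 0`
  have hdet : H.det ≠ 0 := by
    intro h0
    obtain ⟨c', hc0, hc'⟩ := Matrix.exists_vecMul_eq_zero_iff.2 h0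
    have hrel : ∑ i, c' i • Φ i = 0 := by
      refine v.ext fun j => ?_
      have hj : ∑ i, c' i * H i j = 0 := by
        have h := congrFun hc' j
        simpa only [Matrix.vecMul, dotProduct, Pi.zero_apply] using h
      simpa only [LinearMap.coe_sum, Finset.sum_apply, LinearMap.smul_apply, smul_eq_mul, LinearMap.zero_apply,
        H, Matrix.of_apply] using hj
    exact hc0 (funext fun i => Fintype.linearIndependent_iff.1 hliB c' hrel i)
  -- (2) `σ(H) = H · R(σ)`
  have hσH : ∀ σ, (g σ).mapMatrix H = H * (R σ).map (algebraMap P 𝔅.B) := fun σ => by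
    ext i j
    rw [RingHom.mapMatrix_apply, Matrix.map_apply, Matrix.mul_apply]
    simp only [H, Matrix.of_apply, Matrix.map_apply, g, MulSemiringAction.toRingHom_apply]
    exact 𝔅.smul_apply_basis_of_equivariant ρ v (hΦ i) σ j
  -- (3) `det H` is a unit (regularity (iii))
  have hunit : IsUnit H.det := by
    refine 𝔅.isUnit_of_smul_mem H.det hdet fun σ => ⟨(R σ).det, ?_⟩
    have h1 : σ • H.det = (g σ) H.det := rfl
    rw [h1, RingHom.map_det, hσH σ, Matrix.det_mul, ← RingHom.mapMatrix_apply, ← RingHom.map_det,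
      𝔅.algebraMap_eq, mul_comm]
  -- (4) the period-matrix relation `R(σ) · σ(H⁻¹) = H⁻¹`
  have hRC : ∀ σ, (R σ).map (algebraMap P 𝔅.B) * (g σ).mapMatrix H⁻¹ = H⁻¹ := fun σ =>
    calc (R σ).map (algebraMap P 𝔅.B) * (g σ).mapMatrix H⁻¹
        = H⁻¹ * H * ((R σ).map (algebraMap P 𝔅.B) * (g σ).mapMatrix H⁻¹) := by
          rw [Matrix.nonsing_inv_mul H hunit, Matrix.one_mul]
      _ = H⁻¹ * (g σ).mapMatrix (H * H⁻¹) := by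
          rw [map_mul, hσH σ, Matrix.mul_assoc, Matrix.mul_assoc]
      _ = H⁻¹ := by rw [Matrix.mul_nonsing_inv H hunit, map_one, Matrix.mul_one]
  -- (5) the coordinates `γ(σ)` of `c(σ)` and the functional hypothesis `H γ(σ) = σ b − b`
  let γ : Γ → Fin n → 𝔅.B := fun σ k => algebraMap P 𝔅.B (v.repr (c σ) k)
  have hHγ : ∀ σ, H *ᵥ γ σ = fun i => σ • b i - b i := fun σ => by
    funext i
    rw [← hc i σ, 𝔅.apply_eq_sum_basis v (Φ i) (c σ), Matrix.mulVec, dotProduct]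
    refine Finset.sum_congr rfl fun k _ => ?_
    simp only [H, Matrix.of_apply, γ, mul_comm]
  -- (6) the integrating element `x = ∑ₖ (H⁻¹ b)ₖ (1 ⊗ vₖ)`
  refine ⟨∑ i, (H⁻¹ *ᵥ b) i • Algebra.TensorProduct.basis 𝔅.B v i, fun σ => ?_⟩
  have hσx : (fun i => σ • (H⁻¹ *ᵥ b) i) = (g σ).mapMatrix H⁻¹ *ᵥ fun i => σ • b i := by
    funext i
    have h := RingHom.map_mulVec (g σ) H⁻¹ b i
    simp only [g, MulSemiringAction.toRingHom_apply] at h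
    rw [h]
    rfl
  have hcoord : (R σ).map (algebraMap P 𝔅.B) *ᵥ (fun i => σ • (H⁻¹ *ᵥ b) i) - H⁻¹ *ᵥ b = γ σ := by
    rw [hσx, Matrix.mulVec_mulVec, hRC σ, ← Matrix.mulVec_sub]
    have hb : (fun i => σ • b i) - b = H *ᵥ γ σ := by
      rw [hHγ σ]
      rfl
    rw [hb, Matrix.mulVec_mulVec, Matrix.nonsing_inv_mul H hunit, Matrix.one_mulVec]
  rw [𝔅.tensorRep_sum_smul_basis_vec ρ v σ, 𝔅.one_tmul_eq_sum_basis v (c σ), ← Finset.sum_sub_distrib]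
  refine Finset.sum_congr rfl fun k _ => ?_
  rw [← sub_smul]
  exact congrArg (· • Algebra.TensorProduct.basis 𝔅.B v k) (congrFun hcoord k).symm

/-- **Periods detect coboundaries, pair form** (`dim V = 2`, `φ₁ ≠ 0` with values in `Fil^i B`, `φ₂` with a value outside
`Fil^i B`; the elliptic shape `∫ω ∈ Fil¹ ∌ ∫η`): if both periods of `c : Γ → V` are coboundaries, `φ₁(c σ) = σ b₁ − b₁`,
`φ₂(c σ) = σ b₂ − b₂`, then `1 ⊗ c` is a coboundary of `B ⊗_P V`. [cite: Fontaine1982FormesDifferentielles, §5]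
[cite: BlochKato1990, Ex. 3.10.1] -/
theorem exists_tensorRep_sub_eq_of_pair_of_fil [FiniteDimensional P M] (h2 : Module.finrank P M = 2)
    {φ₁ φ₂ : M →ₗ[P] 𝔅.B} (h₁ : ∀ σ m, φ₁ (ρ σ m) = σ • φ₁ m) (h₂' : ∀ σ m, φ₂ (ρ σ m) = σ • φ₂ m)
    {i : ℤ} (hfil : ∀ m, φ₁ m ∈ 𝔅.fil i) (hne : φ₁ ≠ 0) (hnot : ∃ m, φ₂ m ∉ 𝔅.fil i)
    (c : Γ → M) (b₁ b₂ : 𝔅.B) (hc₁ : ∀ σ, φ₁ (c σ) = σ • b₁ - b₁) (hc₂ : ∀ σ, φ₂ (c σ) = σ • b₂ - b₂) :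
    ∃ x : 𝔅.B ⊗[P] M, ∀ σ, ((1 : 𝔅.B) ⊗ₜ[P] c σ : 𝔅.B ⊗[P] M) = 𝔅.tensorRep ρ σ x - x :=
  𝔅.exists_tensorRep_sub_eq_of_equivariant ρ h2 (Φ := ![φ₁, φ₂])
    (fun k σ m => by fin_cases k <;> simp [h₁ σ m, h₂' σ m]) (𝔅.linearIndependent_pair_of_fil hfil hne hnot)
    c ![b₁, b₂] (fun k σ => by fin_cases k <;> simp [hc₁ σ, hc₂ σ])

end PeriodHoms

end Literature.NumberTheory.GaloisRepresentations.PeriodRingData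

/-! ## §2 Tate modules: a cocycle with integrated periods dies in `H¹(F, B ⊗ V_pW)` -/

namespace Literature.NumberTheory.PAdicHodge

open Literature Literature.NumberTheory.GaloisRepresentations Literature.NumberTheory.EllipticCurves WeierstrassCurve
open Literature.NumberTheory.GaloisRepresentations.IsNonarchimedeanLocalField Field ValuativeRel

section Generic

variable {F : Type} [Field F] {p : ℕ} [Fact p.Prime] [Algebra ℚ_[p] F]
  (𝔅 : PeriodRingData.{0, 0, 0, 0} (absoluteGaloisGroup F) ℚ_[p] F)
  {A : Type} [AddCommGroup A] (ρ : GaloisRep F ℚ_[p] (RationalTateModule A p))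
  (act : absoluteGaloisGroup F → TateModule A p → TateModule A p)

/-- **Coboundary in `B ⊗ V_pA` from two integrated periods on the lattice `T_pA`**: `ρ` on the `2`-dimensional `V_pA`
induced by `act`; `φ₁ φ₂ : T_pA →+ B` additive, `ℤ_p`-homogeneous, equivariant, `φ₁ ≠ 0`, `φ₁(T_pA) ⊆ Fil^i`, `φ₂(a) ∉ Fil^i`
for some `a`; `η : Γ_F → T_pA` with `φ₁(η σ) = σ b₁ − b₁`, `φ₂(η σ) = σ b₂ − b₂`. Then
`∃ x ∈ B ⊗ V_pA, ∀ σ, 1 ⊗ η(σ) = σ(x) − x`. [cite: BlochKato1990, Ex. 3.10.1] [cite: FontaineAsterisque223III, Exp. III Thm. 1.5.2] -/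
theorem exists_tensorRep_sub_eq_rationalTateModule_of_periodHoms [Module.Finite ℚ_[p] (RationalTateModule A p)]
    (h2 : Module.finrank ℚ_[p] (RationalTateModule A p) = 2)
    (hρ : ∀ (σ : absoluteGaloisGroup F) (c : ℚ_[p]) (a : TateModule A p),
      ρ σ ((c ⊗ₜ[ℤ_[p]] a : ℚ_[p] ⊗[ℤ_[p]] TateModule A p) : RationalTateModule A p) =
        ((c ⊗ₜ[ℤ_[p]] act σ a : ℚ_[p] ⊗[ℤ_[p]] TateModule A p) : RationalTateModule A p))
    (φ₁ φ₂ : TateModule A p →+ 𝔅.B)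
    (hφ₁ : ∀ (c : ℤ_[p]) (a : TateModule A p), φ₁ (c • a) = (c : ℚ_[p]) • φ₁ a)
    (hφ₂ : ∀ (c : ℤ_[p]) (a : TateModule A p), φ₂ (c • a) = (c : ℚ_[p]) • φ₂ a)
    (hσ₁ : ∀ (σ : absoluteGaloisGroup F) (a : TateModule A p), φ₁ (act σ a) = σ • φ₁ a)
    (hσ₂ : ∀ (σ : absoluteGaloisGroup F) (a : TateModule A p), φ₂ (act σ a) = σ • φ₂ a)
    {i : ℤ} (hfil : ∀ a, φ₁ a ∈ 𝔅.fil i) (hne : ∃ a, φ₁ a ≠ 0) (hnot : ∃ a, φ₂ a ∉ 𝔅.fil i)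
    (η : absoluteGaloisGroup F → TateModule A p) (b₁ b₂ : 𝔅.B)
    (hη₁ : ∀ σ, φ₁ (η σ) = σ • b₁ - b₁) (hη₂ : ∀ σ, φ₂ (η σ) = σ • b₂ - b₂) :
    ∃ x : 𝔅.B ⊗[ℚ_[p]] RationalTateModule A p, ∀ σ,
      ((1 : 𝔅.B) ⊗ₜ[ℚ_[p]] TateModule.toRational p (η σ) : 𝔅.B ⊗[ℚ_[p]] RationalTateModule A p) = 𝔅.tensorRep ρ σ x - x := by
  obtain ⟨Φ₁, hΦ₁, hΦ₁σ⟩ := exists_equivariant_extend_rationalTateModule 𝔅 ρ act hρ φ₁ hφ₁ hσ₁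
  obtain ⟨Φ₂, hΦ₂, hΦ₂σ⟩ := exists_equivariant_extend_rationalTateModule 𝔅 ρ act hρ φ₂ hφ₂ hσ₂
  obtain ⟨a₁, ha₁⟩ := hne
  obtain ⟨a₂, ha₂⟩ := hnot
  refine 𝔅.exists_tensorRep_sub_eq_of_pair_of_fil ρ h2 hΦ₁σ hΦ₂σ (i := i)
    (apply_mem_of_forall_toRational_mem 𝔅 Φ₁ (𝔅.fil i) fun a => by rw [hΦ₁]; exact hfil a)
    (fun h0 => ha₁ ?_) ⟨TateModule.toRational p a₂, by rwa [hΦ₂]⟩ (fun σ => TateModule.toRational p (η σ)) b₁ b₂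
    (fun σ => by rw [hΦ₁, hη₁]) (fun σ => by rw [hΦ₂, hη₂])
  rw [← hΦ₁ a₁, h0, LinearMap.zero_apply]

end Generic

section Elliptic

variable {F : Type} [Field F] [ValuativeRel F] [TopologicalSpace F] [IsNonarchimedeanLocalField F] [CharZero F]
  {p : ℕ} [Fact p.Prime] [Fact (¬ IsUnit (p : integerC F))] [IsAdicComplete (Ideal.span {(p : integerC F)}) (integerC F)]
  (hp : valuation F p < 1) [Algebra ℚ_[p] F]

/-- **A `T_pW`-valued map with integrated periods dies in `H¹(F, B_dR ⊗ V_pW)`** (`W` over a SUBFIELD `K₀ ⊆ F`; the vocabulary of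
the cite-only (S5a) `expStarCoord_eq_zero_iff_kummer`): given two period maps `φ₁ φ₂ : T_pW →+ B_dR(F)` (additive,
`ℤ_p`-homogeneous, `Γ_F`-equivariant through `absGaloisRestrict K₀ F`, `φ₁ ≠ 0`, `φ₁ ⊆ Fil¹ ∌ φ₂(τ)` — intended: `∫ω`, `∫η`) and
`η : Γ_F → T_pW` with `φ₁(η σ) = σ b₁ − b₁`, `φ₂(η σ) = σ b₂ − b₂` (intended: the Kummer cocycle of a rational point, integrated by
`AinfWeierstrassKummerIntegral{,Eta}`), there is `x ∈ B_dR(F) ⊗ V_pW` with `1 ⊗ η(σ) = σ(x) − x` for all `σ`, for the diagonal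
action of `restrictedRationalTateRep W F p` and Fontaine's `bdRPeriodRingData hp`. The `B_dR⁺`-refinement (`IsFilZeroCoboundary`) is
Bloch–Kato Lemma 3.8.1 (sequel). [cite: BlochKato1990, Ex. 3.10.1, (3.11.1)] [cite: Kato1993LNM1553, Ch. II Lemma 1.4.3] -/
theorem exists_tensorRep_sub_eq_restrictedRationalTateRep_of_periodHoms {K₀ : Type} [Field K₀] [CharZero K₀]
    (W : WeierstrassCurve K₀) [W.IsElliptic] [Algebra K₀ F]
    (φ₁ φ₂ : W.tateModule p →+ (bdRPeriodRingData (F := F) (p := p) hp).B)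
    (hφ₁ : ∀ (c : ℤ_[p]) (a : W.tateModule p), φ₁ (c • a) = (c : ℚ_[p]) • φ₁ a)
    (hφ₂ : ∀ (c : ℤ_[p]) (a : W.tateModule p), φ₂ (c • a) = (c : ℚ_[p]) • φ₂ a)
    (hσ₁ : ∀ (σ : absoluteGaloisGroup F) (a : W.tateModule p), φ₁ (absGaloisRestrict K₀ F σ • a) = σ • φ₁ a)
    (hσ₂ : ∀ (σ : absoluteGaloisGroup F) (a : W.tateModule p), φ₂ (absGaloisRestrict K₀ F σ • a) = σ • φ₂ a)
    (hfil : ∀ a, φ₁ a ∈ (bdRPeriodRingData (F := F) (p := p) hp).fil 1) (hne : ∃ a, φ₁ a ≠ 0)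
    (hnot : ∃ a, φ₂ a ∉ (bdRPeriodRingData (F := F) (p := p) hp).fil 1)
    (η : absoluteGaloisGroup F → W.tateModule p) (b₁ b₂ : (bdRPeriodRingData (F := F) (p := p) hp).B)
    (hη₁ : ∀ σ, φ₁ (η σ) = σ • b₁ - b₁) (hη₂ : ∀ σ, φ₂ (η σ) = σ • b₂ - b₂) :
    ∃ x : (bdRPeriodRingData (F := F) (p := p) hp).B ⊗[ℚ_[p]] W.rationalTateModule p, ∀ σ,
      ((1 : (bdRPeriodRingData (F := F) (p := p) hp).B) ⊗ₜ[ℚ_[p]] TateModule.toRational p (η σ) :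
          (bdRPeriodRingData (F := F) (p := p) hp).B ⊗[ℚ_[p]] W.rationalTateModule p) =
        (bdRPeriodRingData (F := F) (p := p) hp).tensorRep (restrictedRationalTateRep W F p) σ x - x := by
  have hpK : (p : K₀) ≠ 0 := Nat.cast_ne_zero.mpr (Fact.out : p.Prime).ne_zero
  haveI : Module.Finite ℚ_[p] (W.rationalTateModule p) := module_finite_rationalTateModule_holds W p
  exact exists_tensorRep_sub_eq_rationalTateModule_of_periodHoms (bdRPeriodRingData (F := F) (p := p) hp)
    (restrictedRationalTateRep W F p) (fun σ a => absGaloisRestrict K₀ F σ • a)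
    (finrank_rationalTateModule_eq_two_holds W p hpK) (fun _ _ _ => rfl) φ₁ φ₂ hφ₁ hφ₂ hσ₁ hσ₂ hfil hne hnot η b₁ b₂ hη₁ hη₂

end Elliptic

end Literature.NumberTheory.PAdicHodge

end
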